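import Summits.QuantumFields.YangMills.Theorems.FradkinShenkerFlowStrongPinningPoincareHeatBathGap
import HarnessLib

/-!
# Robust ball (Y2) — THE HEAT-BATH SWEEP CONTRACTS THE VARIANCE: L² relaxation of the Gibbs sampler of strong-coupling lattice Yang–Mills,
# uniformly in the volume

HONEST FRAMING: venture file of the cell `pub-ymgap` (QuantumFields programme), track ROBUST-BALL, seat rb-p2 (g13).  An ALGORITHMIC reading of the cell's
heat-bath Poincaré inequalities: abstract Markov-operator algebra for the random-scan single-site heat-bath ("Gibbs sampler") operator
`P f (x) = |ι|⁻¹ ∑_i ∫ f(x[i ↦ e]) dν_i^x(e)` of a tilted product measure `μ = (lam^{⊗ι}).tilted V` (the YangMills summit's `StrongPinningPoincare.HeatBath`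
setting), then the lattice Yang–Mills cell.  LATTICE statements at STRONG COUPLING; nothing about `β → ∞`, the continuum or Clay; no Markov-chain object is
constructed — the statements are inequalities between integrals of the iterated operator.
* `HeatBathSweep.variance_sweep_le` (abstract): IF `Var_μ(F) ≤ A ∑_i ∫∫ (F(x) − F(x[i ↦ e]))² dν_i^x dμ` for all bounded measurable `F` (a heat-bath Poincaré
  inequality), THEN for every bounded measurable `f`, `Var_μ(P f) ≤ (1 − (2A|ι|)⁻¹) Var_μ(f)`, and (`variance_sweep_iterate_le`) `Var_μ(P^k f) ≤ (1 − (2A|ι|)⁻¹)^k Var_μ(f)`: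
  ONE SWEEP (`|ι|` single-site updates) contracts the `L²(μ)`-variance by `≈ e^{−1/(2A)}` — relaxation time `≤ 2A` sweeps.  Ingredients: each `P_i` is a
  `μ`-symmetric idempotent averaging (`integral_mul_heatBath_comm`, `integral_heatBath`, `update_idem`), so `∫ (P_i f)² dμ = ∫ f P_i f dμ`
  (`integral_heatBath_sq_eq`); Jensen for the average over `i`; the engine's Dirichlet-form identity `HeatBath.sum_integral_integral_sq_sub_eq`
  (`∑_i ∫∫ (f − f∘[i ↦ e])² = 2|ι| (∫ f² − ∫ f·Pf)`).  (The engine proves the CONVERSE direction — a gap from decay of iterates — for its own purposes.)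
* The lattice Yang–Mills CELLS (`SU(2)` `d = 4` Wilson on `0 ≤ β_W < 2/9` from `HeatBathPoincare.su2_heatBathPoincare`, `A = (2 − 9β_W)⁻¹`: relaxation within
  `(1 − 9β_W/2)⁻¹` sweeps uniformly in the volume; the members of the torus ball from `HeatBathPoincareBall`) are the companion file `HeatBathSweepCells.lean`;
  this file is the measure-theoretic tool (imports only the YangMills summit's heat-bath kernel algebra).
0 sorry, 0 definitions.  References: M. Creutz, Phys. Rev. D 21 (1980) 2308 (the heat-bath algorithm); L. Wu, Ann. Probab. 34 (2006) 1960; P. Diaconis,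
L. Saloff-Coste, Ann. Appl. Probab. 6 (1996) 695 (Poincaré ⇒ L² relaxation).  Everything here is proved. [folklore]
-/

noncomputable section

open MeasureTheory Function Real Finset ProbabilityTheory
open Summit.QuantumFields.YangMills.Theorems.StrongPinningPoincare

namespace Summit.Ventures.YMGap.RobustBall.HeatBathSweep

/-! ### Abstract: the random-scan heat-bath operator of a tilted product measure -/

section Abstract

variable {ι : Type*} [Fintype ι] [DecidableEq ι] {E : Type*} [MeasurableSpace E]
  (lam : Measure E) [IsProbabilityMeasure lam] {V : (ι → E) → ℝ}

/-- **`P_i` is an `L²(μ)`-contraction onto its range: `∫ (P_i f)² dμ = ∫ f · P_i f dμ`** (symmetry of the heat bath and `P_i P_i = P_i`). [folklore] -/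
theorem integral_heatBath_sq_eq (hV : Measurable V) {Bv : ℝ} (hB : ∀ x, |V x| ≤ Bv) (i : ι) {f : (ι → E) → ℝ} (hf : Measurable f)
    {M : ℝ} (hM : ∀ x, |f x| ≤ M) :
    ∫ x, (∫ e, f (update x i e) ∂(lam.tilted fun e => V (update x i e))) ^ 2 ∂((Measure.pi fun _ : ι => lam).tilted V) =
      ∫ x, f x * ∫ e, f (update x i e) ∂(lam.tilted fun e => V (update x i e)) ∂((Measure.pi fun _ : ι => lam).tilted V) := by
  set Pf : (ι → E) → ℝ := fun x => ∫ e, f (update x i e) ∂(lam.tilted fun e => V (update x i e)) with hPf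
  have hPm : Measurable Pf := HeatBath.measurable_heatBath lam hV i hf
  have hPb : ∀ x, |Pf x| ≤ M := fun x => HeatBath.abs_heatBath_le lam hV hB x i hM
  -- `P_i (P_i f) = P_i f` pointwise: `P_i f` does not depend on the coordinate `i`
  have hidem : ∀ x, ∫ e, Pf (update x i e) ∂(lam.tilted fun e => V (update x i e)) = Pf x := fun x => by
    haveI := HeatBath.isProbabilityMeasure_heatBath lam hV hB x i
    have h1 : ∀ e, Pf (update x i e) = Pf x := fun e => by simp only [hPf, update_idem]
    simp_rw [h1]
    simp
  have hsym := HeatBath.integral_mul_heatBath_comm lam hV hB i hf hPm hM hPb (f := f) (h := Pf)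
  -- `∫ Pf · P_i f = ∫ f · P_i Pf = ∫ f · Pf`
  simp_rw [hidem] at hsym
  show ∫ x, Pf x ^ 2 ∂_ = ∫ x, f x * Pf x ∂_
  simp_rw [sq]
  exact hsym

/-- ★★★ **THE HEAT-BATH SWEEP CONTRACTS THE VARIANCE** (abstract): if the tilted product measure `μ` satisfies the heat-bath Poincaré inequality
`Var_μ(F) ≤ A ∑_i ∫∫ (F(x) − F(x[i ↦ e]))² dν_i^x dμ` for every bounded measurable `F`, then the random-scan heat-bath operator
`P f(x) = |ι|⁻¹ ∑_i ∫ f(x[i ↦ e]) dν_i^x(e)` satisfies `Var_μ(P f) ≤ (1 − (2A|ι|)⁻¹) Var_μ(f)` for every bounded measurable `f`. [folklore] -/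
theorem variance_sweep_le [Nonempty ι] (hV : Measurable V) {Bv : ℝ} (hB : ∀ x, |V x| ≤ Bv) {A : ℝ}
    (hP : ∀ (F : (ι → E) → ℝ), Measurable F → (∃ M : ℝ, ∀ x, |F x| ≤ M) →
      variance F ((Measure.pi fun _ : ι => lam).tilted V) ≤
        A * ∑ i, ∫ x, ∫ e, (F x - F (update x i e)) ^ 2 ∂(lam.tilted fun e => V (update x i e)) ∂((Measure.pi fun _ : ι => lam).tilted V))
    (hA : 0 < A) {f : (ι → E) → ℝ} (hf : Measurable f) {M : ℝ} (hM : ∀ x, |f x| ≤ M) :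
    variance (fun x => (Fintype.card ι : ℝ)⁻¹ * ∑ i, ∫ e, f (update x i e) ∂(lam.tilted fun e => V (update x i e)))
        ((Measure.pi fun _ : ι => lam).tilted V) ≤
      (1 - (2 * A * Fintype.card ι)⁻¹) * variance f ((Measure.pi fun _ : ι => lam).tilted V) := by
  haveI := HeatBath.isProbabilityMeasure_gibbs lam hV hB
  set μ := (Measure.pi fun _ : ι => lam).tilted V with hμ
  set n : ℝ := (Fintype.card ι : ℝ) with hn
  have hn0 : 0 < n := by rw [hn]; exact_mod_cast Fintype.card_pos
  set Pi : ι → (ι → E) → ℝ := fun i x => ∫ e, f (update x i e) ∂(lam.tilted fun e => V (update x i e)) with hPi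
  have hPim : ∀ i, Measurable (Pi i) := fun i => HeatBath.measurable_heatBath lam hV i hf
  have hPib : ∀ i x, |Pi i x| ≤ M := fun i x => HeatBath.abs_heatBath_le lam hV hB x i hM
  set Pf : (ι → E) → ℝ := fun x => n⁻¹ * ∑ i, Pi i x with hPf
  have hPfm : Measurable Pf := measurable_const.mul (Finset.measurable_sum _ fun i _ => hPim i)
  have hPfb : ∀ x, |Pf x| ≤ M := fun x => by
    simp only [hPf]
    rw [abs_mul, abs_inv, abs_of_pos hn0]
    calc n⁻¹ * |∑ i, Pi i x| ≤ n⁻¹ * ∑ i, |Pi i x| := mul_le_mul_of_nonneg_left (Finset.abs_sum_le_sum_abs _ _) (inv_nonneg.2 hn0.le)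
      _ ≤ n⁻¹ * ∑ _i : ι, M := mul_le_mul_of_nonneg_left (Finset.sum_le_sum fun i _ => hPib i x) (inv_nonneg.2 hn0.le)
      _ = M := by rw [Finset.sum_const, Finset.card_univ, nsmul_eq_mul, ← hn]; field_simp
  -- integrability
  have hfi : Integrable f μ := HeatBath.integrable_of_abs_le hf hM
  have hf2i : Integrable (fun x => f x ^ 2) μ :=
    HeatBath.integrable_of_abs_le (hf.pow_const 2) fun x => by rw [abs_pow]; exact pow_le_pow_left₀ (abs_nonneg _) (hM x) 2
  have hPfi : Integrable Pf μ := HeatBath.integrable_of_abs_le hPfm hPfb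
  have hPf2i : Integrable (fun x => Pf x ^ 2) μ :=
    HeatBath.integrable_of_abs_le (hPfm.pow_const 2) fun x => by rw [abs_pow]; exact pow_le_pow_left₀ (abs_nonneg _) (hPfb x) 2
  have hfPi : ∀ i, Integrable (fun x => f x * Pi i x) μ := fun i => by
    have hm : Measurable fun x => f x * Pi i x := by exact hf.mul (hPim i)
    exact HeatBath.integrable_of_abs_le hm (C := M * M) fun x => by
      rw [abs_mul]; exact mul_le_mul (hM x) (hPib i x) (abs_nonneg _) ((abs_nonneg _).trans (hM x))
  -- means: `∫ Pf dμ = ∫ f dμ` (DLR)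
  have hmean : ∫ x, Pf x ∂μ = ∫ x, f x ∂μ := by
    have h1 : ∀ i, ∫ x, Pi i x ∂μ = ∫ x, f x ∂μ := fun i => HeatBath.integral_heatBath lam hV hB i hf hM
    simp only [hPf]
    rw [integral_const_mul, integral_finsetSum _ fun i _ => HeatBath.integrable_of_abs_le (hPim i) (hPib i),
      Finset.sum_congr rfl fun i _ => h1 i, Finset.sum_const, Finset.card_univ, nsmul_eq_mul, ← hn]
    field_simp
  -- Jensen for the average: `(Pf)² ≤ n⁻¹ ∑_i (P_i f)²`
  have hjensen : ∀ x, Pf x ^ 2 ≤ n⁻¹ * ∑ i, Pi i x ^ 2 := fun x => by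
    simp only [hPf]
    have h := sq_sum_le_card_mul_sum_sq (s := (Finset.univ : Finset ι)) (f := fun i => Pi i x)
    rw [Finset.card_univ, ← hn] at h
    rw [mul_pow, inv_pow, sq n]
    have hn2 : 0 < n * n := mul_pos hn0 hn0
    rw [inv_mul_le_iff₀ hn2]
    calc (∑ i, Pi i x) ^ 2 ≤ n * ∑ i, Pi i x ^ 2 := h
      _ = n * n * (n⁻¹ * ∑ i, Pi i x ^ 2) := by field_simp
  -- `∫ (Pf)² ≤ n⁻¹ ∑ ∫ f P_i f`
  have hsq : ∫ x, Pf x ^ 2 ∂μ ≤ n⁻¹ * ∑ i, ∫ x, f x * Pi i x ∂μ := by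
    have hPi2i : ∀ i, Integrable (fun x => Pi i x ^ 2) μ := fun i =>
      HeatBath.integrable_of_abs_le ((hPim i).pow_const 2) fun x => by rw [abs_pow]; exact pow_le_pow_left₀ (abs_nonneg _) (hPib i x) 2
    calc ∫ x, Pf x ^ 2 ∂μ ≤ ∫ x, n⁻¹ * ∑ i, Pi i x ^ 2 ∂μ :=
          integral_mono hPf2i ((integrable_finsetSum _ fun i _ => hPi2i i).const_mul _) hjensen
      _ = n⁻¹ * ∑ i, ∫ x, Pi i x ^ 2 ∂μ := by rw [integral_const_mul, integral_finsetSum _ fun i _ => hPi2i i]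
      _ = n⁻¹ * ∑ i, ∫ x, f x * Pi i x ∂μ := by
          congr 1
          exact Finset.sum_congr rfl fun i _ => integral_heatBath_sq_eq lam hV hB i hf hM
  -- the Dirichlet forms (engine: `∑_i ∫∫ (f − f∘[i↦e])² = 2n(∫ f² − ∫ f·Pf)`) and the Poincaré hypothesis
  have hD := HeatBath.sum_integral_integral_sq_sub_eq lam hV hB hf hM
  have hfPf : ∫ x, f x * Pf x ∂μ = n⁻¹ * ∑ i, ∫ x, f x * Pi i x ∂μ := by
    have e1 : ∀ x, f x * Pf x = n⁻¹ * ∑ i, f x * Pi i x := fun x => by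
      simp only [hPf, Finset.mul_sum]
      ring_nf
    simp_rw [e1]
    rw [integral_const_mul, integral_finsetSum _ fun i _ => hfPi i]
  have hPoinc := hP f hf ⟨M, hM⟩
  rw [hD] at hPoinc
  -- variances
  have hmemf : MemLp f 2 μ := MemLp.of_bound hf.aestronglyMeasurable M (ae_of_all _ fun x => by rw [Real.norm_eq_abs]; exact hM x)
  have hmemP : MemLp Pf 2 μ := MemLp.of_bound hPfm.aestronglyMeasurable M (ae_of_all _ fun x => by rw [Real.norm_eq_abs]; exact hPfb x)
  have hvf : variance f μ = (∫ x, f x ^ 2 ∂μ) - (∫ x, f x ∂μ) ^ 2 := by rw [variance_eq_sub hmemf]; rfl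
  have hvP : variance Pf μ = (∫ x, Pf x ^ 2 ∂μ) - (∫ x, Pf x ∂μ) ^ 2 := by rw [variance_eq_sub hmemP]; rfl
  show variance Pf μ ≤ (1 - (2 * A * n)⁻¹) * variance f μ
  rw [hvP, hvf, hmean]
  set S : ℝ := ∑ i, ∫ x, f x * Pi i x ∂μ with hS
  set I2 : ℝ := ∫ x, f x ^ 2 ∂μ with hI2
  set m : ℝ := ∫ x, f x ∂μ with hm
  have h1 : I2 - m ^ 2 ≤ A * (2 * n * (I2 - n⁻¹ * S)) := by
    rw [hvf, hfPf] at hPoinc; exact hPoinc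
  have h2 : (2 * A * n)⁻¹ * (I2 - m ^ 2) ≤ I2 - n⁻¹ * S := by
    rw [inv_mul_le_iff₀ (by positivity)]
    linarith
  calc (∫ x, Pf x ^ 2 ∂μ) - m ^ 2 ≤ n⁻¹ * S - m ^ 2 := by linarith [hsq]
    _ = (I2 - m ^ 2) - (I2 - n⁻¹ * S) := by ring
    _ ≤ (I2 - m ^ 2) - (2 * A * n)⁻¹ * (I2 - m ^ 2) := by linarith [h2]
    _ = (1 - (2 * A * n)⁻¹) * (I2 - m ^ 2) := by ring

/-- ★★★ **ITERATED SWEEPS**: under the same heat-bath Poincaré hypothesis, `Var_μ(P^k f) ≤ (1 − (2A|ι|)⁻¹)^k Var_μ(f)` for every bounded measurable `f` and every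
`k` (with `(2A|ι|)⁻¹ ≤ 1`) — after `k` random-scan single-site heat-bath updates the `L²(μ)`-distance to equilibrium of `f` has contracted geometrically;
`k = |ι|` updates (one sweep) give the factor `≤ e^{−1/(2A)}`. [folklore] -/
theorem variance_sweep_iterate_le [Nonempty ι] (hV : Measurable V) {Bv : ℝ} (hB : ∀ x, |V x| ≤ Bv) {A : ℝ}
    (hP : ∀ (F : (ι → E) → ℝ), Measurable F → (∃ M : ℝ, ∀ x, |F x| ≤ M) →
      variance F ((Measure.pi fun _ : ι => lam).tilted V) ≤
        A * ∑ i, ∫ x, ∫ e, (F x - F (update x i e)) ^ 2 ∂(lam.tilted fun e => V (update x i e)) ∂((Measure.pi fun _ : ι => lam).tilted V))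
    (hA : 0 < A) (hA1 : (2 * A * Fintype.card ι)⁻¹ ≤ 1) {f : (ι → E) → ℝ} (hf : Measurable f) {M : ℝ} (hM : ∀ x, |f x| ≤ M) (k : ℕ) :
    variance ((fun g : (ι → E) → ℝ => fun x => (Fintype.card ι : ℝ)⁻¹ * ∑ i, ∫ e, g (update x i e) ∂(lam.tilted fun e => V (update x i e)))^[k] f)
        ((Measure.pi fun _ : ι => lam).tilted V) ≤
      (1 - (2 * A * Fintype.card ι)⁻¹) ^ k * variance f ((Measure.pi fun _ : ι => lam).tilted V) := by
  set T : ((ι → E) → ℝ) → (ι → E) → ℝ := fun g x => (Fintype.card ι : ℝ)⁻¹ * ∑ i, ∫ e, g (update x i e) ∂(lam.tilted fun e => V (update x i e)) with hT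
  have hn0 : (0 : ℝ) < Fintype.card ι := by exact_mod_cast Fintype.card_pos
  -- `T` preserves "measurable and bounded by `M`"
  have hTm : ∀ {g : (ι → E) → ℝ}, Measurable g → Measurable (T g) := fun hg =>
    measurable_const.mul (Finset.measurable_sum _ fun i _ => HeatBath.measurable_heatBath lam hV i hg)
  have hTb : ∀ {g : (ι → E) → ℝ}, Measurable g → (∀ x, |g x| ≤ M) → ∀ x, |T g x| ≤ M := fun hg hgb x => by
    simp only [hT]
    rw [abs_mul, abs_inv, abs_of_pos hn0]
    calc (Fintype.card ι : ℝ)⁻¹ * |∑ i, ∫ e, _ ∂_| ≤ (Fintype.card ι : ℝ)⁻¹ * ∑ i, |∫ e, _ ∂_| :=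
          mul_le_mul_of_nonneg_left (Finset.abs_sum_le_sum_abs _ _) (inv_nonneg.2 hn0.le)
      _ ≤ (Fintype.card ι : ℝ)⁻¹ * ∑ _i : ι, M :=
          mul_le_mul_of_nonneg_left (Finset.sum_le_sum fun i _ => HeatBath.abs_heatBath_le lam hV hB x i hgb) (inv_nonneg.2 hn0.le)
      _ = M := by rw [Finset.sum_const, Finset.card_univ, nsmul_eq_mul]; field_simp
  -- induction on `k`, carrying measurability and the bound
  have key : ∀ k : ℕ, Measurable (T^[k] f) ∧ (∀ x, |(T^[k] f) x| ≤ M) ∧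
      variance (T^[k] f) ((Measure.pi fun _ : ι => lam).tilted V) ≤
        (1 - (2 * A * Fintype.card ι)⁻¹) ^ k * variance f ((Measure.pi fun _ : ι => lam).tilted V) := by
    intro k
    induction k with
    | zero => exact ⟨hf, hM, by simp⟩
    | succ k ih =>
      obtain ⟨hkm, hkb, hkv⟩ := ih
      refine ⟨?_, ?_, ?_⟩
      · rw [Function.iterate_succ_apply']; exact hTm hkm
      · rw [Function.iterate_succ_apply']; exact hTb hkm hkb
      · rw [Function.iterate_succ_apply', pow_succ, mul_comm (_ ^ k), mul_assoc]
        exact (variance_sweep_le lam hV hB hP hA hkm hkb).trans (mul_le_mul_of_nonneg_left hkv (by linarith))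
  exact (key k).2.2

end Abstract

end Summit.Ventures.YMGap.RobustBall.HeatBathSweep

end
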